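import Mathlib

/-!
# `SL₂(K)` over a finite field: unitriangular generators and a primitive additive character
# (negative-side support for `stub_subfieldCell`, crux `GradedDesignFamily`, stmt-MatrixMultiplication-7610; file 1/2)

Elementary ingredients of the minimal-degree bound for `SL₂(K)` proved in the companion file
`Negative/SL2MinDegree.lean`:

* the elements `u_x = [[1,x],[0,1]]`, `l_x = [[1,0],[x,1]]`, `t_c = diag(c,c⁻¹)`, `w = [[0,1],[-1,0]]` of
  `SL₂(K)` and their relations `u_x u_y = u_{x+y}`, `t_c u_x = u_{c²x} t_c`, `w u_{-x} = l_x w`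
  (`sl2md_upper_mul`, `sl2md_diag_mul_upper`, `sl2md_weyl_mul_upper`), and the explicit decomposition of
  every element as a word `u_a l_c u_b l_d` (`sl2md_decomp`: `SL₂(K)` is generated by unitriangulars);
* a PRIMITIVE additive character `ψ : K → ℂ` of any finite field (`sl2md_exists_isPrimitive`:
  `x ↦ e(ℓ(x))` for a non-zero `𝔽_p`-linear functional `ℓ` and the standard character `e` of `ZMod p`;
  primitivity = every shift `x ↦ ψ(a x)`, `a ≠ 0`, is non-trivial) and the orthogonality of its shifts
  `Σ_a ψ(a x) = |K|·[x = 0]` (`sl2md_sum_shift`).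

Sorry-free; axioms `propext`, `Classical.choice`, `Quot.sound`.
-/

set_option linter.dupNamespace false

noncomputable section

open scoped BigOperators

namespace Summit.MatrixMultiplication.MatrixMultiplication.Theorems.GradedDesignFamily.Negative

section SL2Generators

variable {K : Type} [Field K]

/-! ## Elements of `SL₂(K)` and their relations -/

/-- `det [[1,x],[0,1]] = 1`. [folklore] -/
theorem sl2md_det_upper (x : K) : Matrix.det !![(1 : K), x; 0, 1] = 1 := by
  simp [Matrix.det_fin_two_of]

/-- `det [[1,0],[x,1]] = 1`. [folklore] -/
theorem sl2md_det_lower (x : K) : Matrix.det !![(1 : K), 0; x, 1] = 1 := by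
  simp [Matrix.det_fin_two_of]

/-- `det diag(c, c⁻¹) = 1`. [folklore] -/
theorem sl2md_det_diag (c : Kˣ) : Matrix.det !![((c : Kˣ) : K), 0; 0, ((c⁻¹ : Kˣ) : K)] = 1 := by
  simp [Matrix.det_fin_two_of]

/-- `det [[0,1],[-1,0]] = 1`. [folklore] -/
theorem sl2md_det_weyl : Matrix.det !![(0 : K), 1; -1, 0] = 1 := by
  simp [Matrix.det_fin_two_of]

/-- `u_x u_y = u_{x+y}`. [folklore] -/
theorem sl2md_upper_mul (x y : K) :
    (⟨_, sl2md_det_upper x⟩ * ⟨_, sl2md_det_upper y⟩ : Matrix.SpecialLinearGroup (Fin 2) K) =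
      ⟨_, sl2md_det_upper (x + y)⟩ := by
  refine Matrix.SpecialLinearGroup.ext _ _ fun i j => ?_
  rw [Matrix.SpecialLinearGroup.coe_mul]
  fin_cases i <;> fin_cases j <;> simp [Matrix.mul_apply, Fin.sum_univ_two, add_comm]

/-- `u_0 = 1`. [folklore] -/
theorem sl2md_upper_zero :
    (⟨_, sl2md_det_upper (0 : K)⟩ : Matrix.SpecialLinearGroup (Fin 2) K) =
      (1 : Matrix.SpecialLinearGroup (Fin 2) K) := by
  refine Matrix.SpecialLinearGroup.ext _ _ fun i j => ?_
  rw [Matrix.SpecialLinearGroup.coe_one]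
  fin_cases i <;> fin_cases j <;> simp

/-- `l_0 = 1`. [folklore] -/
theorem sl2md_lower_zero :
    (⟨_, sl2md_det_lower (0 : K)⟩ : Matrix.SpecialLinearGroup (Fin 2) K) =
      (1 : Matrix.SpecialLinearGroup (Fin 2) K) := by
  refine Matrix.SpecialLinearGroup.ext _ _ fun i j => ?_
  rw [Matrix.SpecialLinearGroup.coe_one]
  fin_cases i <;> fin_cases j <;> simp

/-- The diagonal torus normalises `U`: `t_c u_x = u_{c² x} t_c`. [folklore] -/
theorem sl2md_diag_mul_upper (c : Kˣ) (x : K) :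
    (⟨_, sl2md_det_diag c⟩ * ⟨_, sl2md_det_upper x⟩ : Matrix.SpecialLinearGroup (Fin 2) K) =
      ⟨_, sl2md_det_upper ((c : K) * c * x)⟩ * ⟨_, sl2md_det_diag c⟩ := by
  refine Matrix.SpecialLinearGroup.ext _ _ fun i j => ?_
  rw [Matrix.SpecialLinearGroup.coe_mul, Matrix.SpecialLinearGroup.coe_mul]
  have hc : (c : K) * (c : K)⁻¹ = 1 := mul_inv_cancel₀ c.ne_zero
  fin_cases i <;> fin_cases j <;> simp [Matrix.mul_apply, Fin.sum_univ_two]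
  linear_combination (-(c : K) * x) * hc

/-- The Weyl element conjugates `U` to the lower unitriangulars: `w u_{-x} = l_x w`. [folklore] -/
theorem sl2md_weyl_mul_upper (x : K) :
    (⟨_, sl2md_det_weyl⟩ * ⟨_, sl2md_det_upper (-x)⟩ : Matrix.SpecialLinearGroup (Fin 2) K) =
      ⟨_, sl2md_det_lower x⟩ * ⟨_, sl2md_det_weyl⟩ := by
  refine Matrix.SpecialLinearGroup.ext _ _ fun i j => ?_
  rw [Matrix.SpecialLinearGroup.coe_mul, Matrix.SpecialLinearGroup.coe_mul]
  fin_cases i <;> fin_cases j <;> simp [Matrix.mul_apply, Fin.sum_univ_two]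

/-- **`SL₂(K)` is generated by unitriangulars, explicitly**: every `g` is a word
`u_a l_c u_b l_d`. [folklore] -/
theorem sl2md_decomp (g : Matrix.SpecialLinearGroup (Fin 2) K) :
    ∃ a b c d : K, g = ⟨_, sl2md_det_upper a⟩ * ⟨_, sl2md_det_lower c⟩ * ⟨_, sl2md_det_upper b⟩ *
      ⟨_, sl2md_det_lower d⟩ := by
  set A := (g : Matrix (Fin 2) (Fin 2) K) 0 0 with hA
  set B := (g : Matrix (Fin 2) (Fin 2) K) 0 1 with hB
  set C := (g : Matrix (Fin 2) (Fin 2) K) 1 0 with hC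
  set D := (g : Matrix (Fin 2) (Fin 2) K) 1 1 with hD
  have hdet : A * D - B * C = 1 := by
    have := g.prop
    rw [Matrix.det_fin_two] at this
    exact this
  by_cases hc : C = 0
  · -- `C = 0`: then `A D = 1`, `D ≠ 0`, and `g = u_{(A+B-1)/D} l_D u_{(D-1)/D} l_{-1}`
    have hAD : A * D = 1 := by rw [hc, mul_zero, sub_zero] at hdet; exact hdet
    have hD0 : D ≠ 0 := fun h => by rw [h, mul_zero] at hAD; exact zero_ne_one hAD
    refine ⟨(A + B - 1) / D, (D - 1) / D, D, -1, ?_⟩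
    refine Matrix.SpecialLinearGroup.ext _ _ fun i j => ?_
    simp only [Matrix.SpecialLinearGroup.coe_mul]
    fin_cases i <;> fin_cases j
    · simp [Matrix.mul_apply, Fin.sum_univ_two, ← hA]
      field_simp
      linear_combination hAD
    · simp [Matrix.mul_apply, Fin.sum_univ_two, ← hB]
      field_simp
      linear_combination -hAD
    · simp [Matrix.mul_apply, Fin.sum_univ_two, ← hC, hc]
      field_simp
      ring
    · simp [Matrix.mul_apply, Fin.sum_univ_two, ← hD]
      field_simp
      ring
  · -- `C ≠ 0`: `g = u_{(A-1)/C} l_C u_{(D-1)/C}`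
    refine ⟨(A - 1) / C, (D - 1) / C, C, 0, ?_⟩
    rw [sl2md_lower_zero, mul_one]
    refine Matrix.SpecialLinearGroup.ext _ _ fun i j => ?_
    simp only [Matrix.SpecialLinearGroup.coe_mul]
    fin_cases i <;> fin_cases j
    · simp [Matrix.mul_apply, Fin.sum_univ_two, ← hA]
      field_simp
      ring
    · simp [Matrix.mul_apply, Fin.sum_univ_two, ← hB]
      field_simp
      linear_combination -hdet
    · simp [Matrix.mul_apply, Fin.sum_univ_two, ← hC]
    · simp [Matrix.mul_apply, Fin.sum_univ_two, ← hD]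
      field_simp
      ring

/-! ## A primitive additive character of a finite field, with values in `ℂ` -/

variable [Fintype K]

/-- Every finite field has a PRIMITIVE additive character `K → ℂ` (all shifts `x ↦ ψ(a x)`, `a ≠ 0`, are
non-trivial): `x ↦ e(ℓ(x))` for a non-zero `𝔽_p`-linear functional `ℓ : K → 𝔽_p` and the standard
character `e` of `ZMod p`. [folklore] -/
theorem sl2md_exists_isPrimitive : ∃ ψ : AddChar K ℂ, ψ.IsPrimitive := by
  classical
  set p := ringChar K with hp
  haveI hprime : Fact p.Prime := ⟨CharP.prime_ringChar K⟩
  letI : Algebra (ZMod p) K := ZMod.algebra _ _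
  -- a non-zero linear functional
  obtain ⟨ℓ, hℓ⟩ : ∃ ℓ : K →ₗ[ZMod p] ZMod p, ℓ 1 ≠ 0 := by
    by_contra hall
    push Not at hall
    exact one_ne_zero ((Module.forall_dual_apply_eq_zero_iff (ZMod p) (1 : K)).1 hall)
  refine ⟨(ZMod.stdAddChar (N := p)).compAddMonoidHom ℓ.toAddMonoidHom, ?_⟩
  intro a ha hone
  -- `ψ(a x) = 1` for all `x`; at `x = a⁻¹` this says `e(ℓ 1) = 1`
  have hx : (ZMod.stdAddChar (N := p)) (ℓ 1) = 1 := by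
    have := DFunLike.congr_fun hone a⁻¹
    simpa [AddChar.mulShift_apply, mul_inv_cancel₀ ha] using this
  -- the standard character of `ZMod p` takes the value `1` only at `0`
  apply ZMod.isPrimitive_stdAddChar p hℓ
  ext t
  rw [AddChar.mulShift_apply, AddChar.one_apply]
  obtain ⟨n, rfl⟩ := ZMod.natCast_zmod_surjective t
  rw [mul_comm, ← nsmul_eq_mul, AddChar.map_nsmul_eq_pow, hx, one_pow]

/-- Orthogonality of the shifts of a primitive character: `Σ_a ψ(a x) = |K|·[x = 0]`. [folklore] -/
theorem sl2md_sum_shift [DecidableEq K] {ψ : AddChar K ℂ} (hψ : ψ.IsPrimitive) (x : K) :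
    ∑ a : K, ψ (a * x) = if x = 0 then (Fintype.card K : ℂ) else 0 := by
  split_ifs with hx
  · simp [hx]
  · have h1 : ψ.mulShift x ≠ 1 := hψ hx
    have := AddChar.sum_eq_zero_of_ne_one h1
    simpa [AddChar.mulShift_apply, mul_comm] using this

end SL2Generators

end Summit.MatrixMultiplication.MatrixMultiplication.Theorems.GradedDesignFamily.Negative

end
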